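import Summits.ResolutionOfSingularities.ResolutionOfSingularities.Theses.FoliationDescent
import Literature.AlgebraicGeometry.Resolution.LocalUniformization
import Mathlib.RingTheory.RegularLocalRing.Defs
import HarnessLib

/-!
# Bridge STATEMENT (lead c1 of crux `Pialt`, stmt-ResolutionOfSingularities-0555): route
# `FoliationDescent`'s `FolLU ∧ LogCanQuotLU` should give RRLU1 over perfect fields

Workfile (statement only, `sorry`): the precise target that would plug route `FoliationDescent`
(`Theses/FoliationDescent.lean`: `FolLU`, `LogCanQuotLU`) into the lead's descent
`Theorems/PAlterationPialtSqueezeRRLU1.lean` (`isLocallyUniformizable_of_temkin2013_of_rrLU1_at`,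
`hasResolution_of_temkin2013_of_rrLU1_at_of_twoModelPatching_at`), bypassing that route's
`DualSandwich` / `TorsorLUPerfect` / `TorsorToLurelPerfect`: the conclusion below is RRLU1 at `p`
restricted to PERFECT ground fields, binder for binder as the descent consumes it.

Proof plan (not carried out here): for `L = K(y)`, `y ^ p = a ∈ K`, `y ∉ K`, let `D` be the
`K`-derivation `d/dy` of `L ≅ K[X]/(X^p − a)` (`Polynomial.derivative'` descends because
`(X^p − a)' = 0`; or define it on the power basis `1, y, …, y^{p-1}`): `D ≠ 0`, `D^[p] = 0 = 0 • D`,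
`ker D = K`. Apply `FolLU` to `(k, L, O, S := B, D)` (`B` regular everywhere, so regular at the
centre), then `LogCanQuotLU` with `R := ⊥`: it returns a finitely generated `A ⊆ O` of
`D`-constants (so `A ⊆ K`) with `Frac A = ker D = K`, regular at the centre; transport `A` along
`K → L` (`Subalgebra.comap`) to an affine model of `K` inside `O ∩ K`, regular at the centre —
i.e. `IsLocallyUniformizable k K (O ∩ K)`. The degenerate case `y ∈ K` is `B ∩ K ≅ B` regular.
-/

set_option linter.dupNamespace false

noncomputable section

open IsLocalRing
open Literature.AlgebraicGeometry.Resolution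
open Summit.ResolutionOfSingularities.ResolutionOfSingularities.Theses.FoliationDescent (FolLU LogCanQuotLU)

namespace Summit.ResolutionOfSingularities.ResolutionOfSingularities.Theorems.Pialt.RadiciallyRegular

/-- BRIDGE TARGET (statement only): `FolLU → LogCanQuotLU → RRLU1_p` over PERFECT ground fields. -/
theorem rrLU1_perfect_of_folLU_of_logCanQuotLU (hF : FolLU) (hQ : LogCanQuotLU) (p : ℕ)
    (hp : p.Prime) :
    ∀ (k K L : Type) [Field k] [CharP k p] [PerfectField k] [Field K] [Field L] [Algebra k K]
      [Algebra K L] [Algebra k L] [IsScalarTower k K L], (⊤ : IntermediateField k K).FG →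
      IsPurelyInseparable K L →
      (∃ y : L, y ^ p ∈ (algebraMap K L).range ∧ IntermediateField.adjoin K {y} = ⊤) →
      ∀ B : Subalgebra k L, B.FG → IsFractionRing B L → IsRegularRing B →
      ∀ O : ValuationSubring L, B.toSubring ≤ O.toSubring →
        IsLocallyUniformizable k K (O.comap (algebraMap K L)) := by
  sorry

end Summit.ResolutionOfSingularities.ResolutionOfSingularities.Theorems.Pialt.RadiciallyRegular

end
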